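import Mathlib
import Literature.Analysis.FluidPDE.VectorCalculus
import Literature.Analysis.FluidPDE.DifferentiableGaussGreen
import Summits.NavierStokesRegularity.NavierStokesRegularity.Theorems.UnthreadedDoorFluxStarvedDipolePotentialCalculus
import Summits.NavierStokesRegularity.NavierStokesRegularity.Theorems.ThreadingFluxHorizonTowerZonalFrame
import HarnessLib

/-!
# Route `UnthreadedDoor`, crux `PoloidalLiouville` (stmt-NavierStokesRegularity-1222), wall W1 — crux idea
# «flux-starved-dipoles» (ns-idea-15 g12/g13, `Cruxes/PoloidalLiouville/FluxStarvedDipoleSketch.lean`):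
# the LOOP LAWS on dipolar spheres (card §Proof steps 1–2, first inputs of `FluxStarvationSteady`)

After `…FluxStarvedDipoleAmplitudeLaw` (p837161) K1 `DipoleNeverSteady` rests on the single typed Prop `FluxStarvationSteady`
(a `C¹` incompressible drift maintaining a steady turning-axis dipole potential `T(x) = ⟪A(‖x−x₀‖), x−x₀⟫/‖x−x₀‖ + R(‖x−x₀‖)`
is tangent to every non-solid dipolar sphere).  Its paper proof (card §Proof) starts with two LOOP LAWS on each sphere `S_r(x₀)`
with `A(r) ≠ 0`: the level sets of `T|_{S_r}` are the latitude circles of the axis `Â(r)`, and along them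
(1) the loop momentum `m = ⟪u, x − x₀⟫` is constant (radial component of the steady kinematic law
`∇L × (x−x₀) = ∇m × ∇T`, `L := ⟪u,∇T⟫ − ΔT`), and (2) the reduced scalar `L` is constant (its `∇T`-component).
THIS FILE proves both, for the explicit latitude circles `φ ↦ x₀ + rc·Â + rs·(cos φ·e + sin φ·(Â × e))` (`c² + s² = 1`,
`e ⊥ Â` a unit vector):

* `dipole_gradient_sphere` — on `S_r(x₀)`: `∇T(x₀ + y) = r⁻¹·A(r) + κ·y` (the tangential gradient of the dipole potential is the
  projection of the FIXED vector `A(r)/r`; frame expansion + `PointSource.gradient_potential`);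
* `latitudeCircle_mem_sphere`, `hasDerivAt_latitudeCircle`, `cross_axis_latitudeCircle` — the circles lie on `S_r(x₀)` and
  their velocity is `Â × (x − x₀)`;
* `loopMomentum_const_on_latitudeCircle` (step 1) and `reducedScalar_const_on_latitudeCircle` (step 2).

What remains for `FluxStarvationSteady` after this file: the `τ`-component of the law (`N_c = M_r/r`), the incompressibility
condition averaged over latitude circles (the sketch's ring identity `averaged_cancellation`), and zero net flux of a
divergence-free field through spheres.

HONEST LABEL: linear kinematic shadow of W1 (critic V28: information-grade, W1 movement 0); `FluxStarvationSteady`, K1,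
`PoloidalLiouville` (1222), its wall `stub_scalarLiouville` and the summit stay OPEN; NO Navier–Stokes regularity statement is
proved.  `--supports stmt-NavierStokesRegularity-1222` (helper).  [folklore]
-/

noncomputable section

-- the summit and its single sub-problem share the name (CONVENTIONS §1)
set_option linter.dupNamespace false

open Set Filter Topology InnerProductSpace
open scoped RealInnerProductSpace Laplacian
open Literature.Analysis.FluidPDE
open Summit.NavierStokesRegularity.NavierStokesRegularity.Theorems.PoloidalLiouville.KinematicShadow (PointSource.cross_smul_right
  PointSource.cross_add_right PointSource.cross_self PointSource.cross_anticomm)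
open Summit.NavierStokesRegularity.NavierStokesRegularity.Theorems.PoloidalLiouville.HorizonTower.Zonal (inner_cross_self_left
  inner_cross_self_right norm_cross_sq cross_cross_left_of_orthonormal)

namespace Summit.NavierStokesRegularity.NavierStokesRegularity.Theorems.PoloidalLiouville.FluxStarvedDipole

/-! ### The gradient of the dipole potential on a sphere -/

/-- `∇(f + g) = ∇f + ∇g` at a point of differentiability. [folklore] -/
theorem gradient_add_apply {f g : EuclideanSpace ℝ (Fin 3) → ℝ} {x : EuclideanSpace ℝ (Fin 3)}
    (hf : DifferentiableAt ℝ f x) (hg : DifferentiableAt ℝ g x) :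
    gradient (f + g) x = gradient f x + gradient g x := by
  rw [gradient, gradient, gradient, fderiv_add hf hg, map_add]

/-- **The gradient of the dipole potential on `S_r(x₀)`**: `∇T(x₀ + y) = r⁻¹·A(r) + κ·y` for `‖y‖ = r > 0` — off its
radial part, the gradient is the fixed vector `A(r)/r`. [folklore] -/
theorem dipole_gradient_sphere {A : ℝ → EuclideanSpace ℝ (Fin 3)} {R : ℝ → ℝ} {x₀ : EuclideanSpace ℝ (Fin 3)}
    {T : EuclideanSpace ℝ (Fin 3) → ℝ}
    (hT : ∀ z, T z = ⟪A ‖z - x₀‖, z - x₀⟫ / ‖z - x₀‖ + R ‖z - x₀‖)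
    (hA : ContDiffOn ℝ 3 A (Ioi 0)) (hR : ContDiffOn ℝ 3 R (Ioi 0)) {r : ℝ} (hr : 0 < r)
    {y : EuclideanSpace ℝ (Fin 3)} (hy : ‖y‖ = r) :
    ∃ κ : ℝ, gradient T (x₀ + y) = r⁻¹ • A r + κ • y := by
  set b : OrthonormalBasis (Fin 3) ℝ (EuclideanSpace ℝ (Fin 3)) := EuclideanSpace.basisFun (Fin 3) ℝ with hb
  choose P₁ p₂ hP hP₁ hP2 hval using fun i : Fin 3 => profile_calculus hA (b i) hr
  obtain ⟨g₁, g₂, hg, hg₁, hg2⟩ := radial_calculus hR hr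
  have hy2 : ‖y‖ ^ 2 = r ^ 2 := by rw [hy]
  have hyU : ‖y‖ ^ 2 ∈ Ioi (0 : ℝ) := by rw [hy2]; exact pow_pos hr 2
  have hsq : Real.sqrt (‖y‖ ^ 2) = r := by rw [hy2]; exact Real.sqrt_sq hr.le
  -- the summands, as functions
  set t : Fin 3 → EuclideanSpace ℝ (Fin 3) → ℝ :=
    fun i z => ⟪b i, z⟫ * (⟪A (Real.sqrt (‖z‖ ^ 2)), b i⟫ / Real.sqrt (‖z‖ ^ 2)) with ht
  set rad : EuclideanSpace ℝ (Fin 3) → ℝ := fun z => R (Real.sqrt (‖z‖ ^ 2)) with hrad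
  have hS : (fun z => T (x₀ + z)) = t 0 + t 1 + t 2 + rad := by
    funext z
    rw [dipole_frame_expansion hT b z]
    simp only [ht, hrad, Fin.sum_univ_three, Pi.add_apply]
  have h1 : gradient T (x₀ + y) = gradient (t 0 + t 1 + t 2 + rad) y := by
    rw [← hS]
    simp only [gradient, fderiv_comp_add_left]
  -- gradients and differentiability of the summands at `y`
  have hgt : ∀ i, gradient (t i) y = (⟪A r, b i⟫ / r) • b i + (2 * ⟪b i, y⟫ * P₁ i (‖y‖ ^ 2)) • y := fun i => by
    have h := KinematicShadow.PointSource.gradient_potential (e := b i) (hP i _ hyU)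
    rw [hsq] at h
    exact h
  have hdt : ∀ i, DifferentiableAt ℝ (t i) y := fun i =>
    ((innerSL ℝ (b i) : EuclideanSpace ℝ (Fin 3) →L[ℝ] ℝ).differentiableAt).mul
      (hasFDerivAt_comp_norm_sq (hP i _ hyU)).differentiableAt
  have hgrad_rad : gradient rad y = (2 * g₁ (‖y‖ ^ 2)) • y := HorizonTower.gradient_comp_norm_sq (hg _ hyU)
  have hdrad : DifferentiableAt ℝ rad y := (hasFDerivAt_comp_norm_sq (hg _ hyU)).differentiableAt
  -- the fixed vector `Σᵢ (⟪A r, bᵢ⟫/r) bᵢ = A(r)/r`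
  have hrep : r⁻¹ • A r = (⟪A r, b 0⟫ / r) • b 0 + (⟪A r, b 1⟫ / r) • b 1 + (⟪A r, b 2⟫ / r) • b 2 := by
    have h := b.sum_repr' (A r)
    rw [Fin.sum_univ_three] at h
    rw [real_inner_comm (b 0) (A r), real_inner_comm (b 1) (A r), real_inner_comm (b 2) (A r)]
    conv_lhs => rw [← h]
    simp only [smul_add, smul_smul, div_eq_inv_mul]
  refine ⟨2 * ⟪b 0, y⟫ * P₁ 0 (‖y‖ ^ 2) + 2 * ⟪b 1, y⟫ * P₁ 1 (‖y‖ ^ 2) + 2 * ⟪b 2, y⟫ * P₁ 2 (‖y‖ ^ 2)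
    + 2 * g₁ (‖y‖ ^ 2), ?_⟩
  rw [h1, gradient_add_apply (((hdt 0).add (hdt 1)).add (hdt 2)) hdrad,
    gradient_add_apply ((hdt 0).add (hdt 1)) (hdt 2), gradient_add_apply (hdt 0) (hdt 1),
    hgt 0, hgt 1, hgt 2, hgrad_rad, hrep]
  module

/-! ### Latitude circles of the axis -/

/-- The latitude circle of colatitude data `(c, s)` (`c² + s² = 1`) about the axis `n` through `x₀`, radius `r`, in the
frame `(n, e, n × e)`: `φ ↦ x₀ + rc·n + rs·(cos φ·e + sin φ·(n × e))`.  On `S_r(x₀)` these are the level sets of the dipole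
potential with axis `Â(r) = n`. [folklore] -/
theorem latitudeCircle_mem_sphere {n e x₀ : EuclideanSpace ℝ (Fin 3)} (hn : ‖n‖ = 1) (he : ‖e‖ = 1) (hne : ⟪n, e⟫ = 0)
    {r c s : ℝ} (hr : 0 < r) (hcs : c ^ 2 + s ^ 2 = 1) (φ : ℝ) :
    ‖(x₀ + (r * c) • n + (r * s) • (Real.cos φ • e + Real.sin φ • cross n e)) - x₀‖ = r := by
  have hf1 : ‖cross n e‖ = 1 := by
    have h := norm_cross_sq n e
    rw [hn, he, hne] at h
    nlinarith [norm_nonneg (cross n e)]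
  have hnf : ⟪n, cross n e⟫ = 0 := by rw [real_inner_comm]; exact inner_cross_self_left n e
  have hef : ⟪e, cross n e⟫ = 0 := by rw [real_inner_comm]; exact inner_cross_self_right n e
  have hnn : ⟪n, n⟫ = 1 := by rw [real_inner_self_eq_norm_sq, hn, one_pow]
  have hee : ⟪e, e⟫ = 1 := by rw [real_inner_self_eq_norm_sq, he, one_pow]
  have hff : ⟪cross n e, cross n e⟫ = 1 := by rw [real_inner_self_eq_norm_sq, hf1, one_pow]
  have hen : ⟪e, n⟫ = 0 := by rw [real_inner_comm]; exact hne
  have hfn : ⟪cross n e, n⟫ = 0 := inner_cross_self_left n e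
  have hfe : ⟪cross n e, e⟫ = 0 := inner_cross_self_right n e
  have hcs' : Real.cos φ ^ 2 + Real.sin φ ^ 2 = 1 := Real.cos_sq_add_sin_sq φ
  have hsq : ‖(r * c) • n + (r * s) • (Real.cos φ • e + Real.sin φ • cross n e)‖ ^ 2 = r ^ 2 := by
    rw [← real_inner_self_eq_norm_sq]
    simp only [inner_add_left, inner_add_right, real_inner_smul_left, real_inner_smul_right, hnn, hee, hff, hne,
      hen, hnf, hfn, hef, hfe]
    linear_combination r ^ 2 * hcs + r ^ 2 * s ^ 2 * hcs'
  rw [add_assoc, add_sub_cancel_left]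
  have h0 : 0 ≤ ‖(r * c) • n + (r * s) • (Real.cos φ • e + Real.sin φ • cross n e)‖ := norm_nonneg _
  nlinarith [hsq, hr]

/-- Velocity of the latitude circle. [folklore] -/
theorem hasDerivAt_latitudeCircle (n e x₀ : EuclideanSpace ℝ (Fin 3)) (r c s φ : ℝ) :
    HasDerivAt (fun φ : ℝ => x₀ + (r * c) • n + (r * s) • (Real.cos φ • e + Real.sin φ • cross n e))
      ((r * s) • ((-Real.sin φ) • e + Real.cos φ • cross n e)) φ := by
  have h1 : HasDerivAt (fun φ : ℝ => Real.cos φ • e) ((-Real.sin φ) • e) φ := (Real.hasDerivAt_cos φ).smul_const e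
  have h2 : HasDerivAt (fun φ : ℝ => Real.sin φ • cross n e) (Real.cos φ • cross n e) φ :=
    (Real.hasDerivAt_sin φ).smul_const _
  exact ((h1.add h2).const_smul (r * s)).const_add (x₀ + (r * c) • n)

/-- The velocity of the latitude circle is `n × (x − x₀)` (frame identity `n × (n × e) = −e`). [folklore] -/
theorem cross_axis_latitudeCircle {n e x₀ : EuclideanSpace ℝ (Fin 3)} (hn : ‖n‖ = 1) (hne : ⟪n, e⟫ = 0)
    (r c s φ : ℝ) :
    cross n ((x₀ + (r * c) • n + (r * s) • (Real.cos φ • e + Real.sin φ • cross n e)) - x₀)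
      = (r * s) • ((-Real.sin φ) • e + Real.cos φ • cross n e) := by
  have hnne : cross n (cross n e) = -e := by
    rw [PointSource.cross_anticomm n (cross n e), cross_cross_left_of_orthonormal hn hne]
  rw [add_assoc, add_sub_cancel_left, PointSource.cross_add_right, PointSource.cross_smul_right,
    PointSource.cross_smul_right, PointSource.cross_self, smul_zero, zero_add, PointSource.cross_add_right,
    PointSource.cross_smul_right, PointSource.cross_smul_right, hnne, smul_neg, ← neg_smul, add_comm]

/-! ### The loop laws -/

/-- **LOOP LAW, step 1: the loop momentum is constant on latitude circles.**  Let `u ∈ C¹`, `A, R ∈ C³(0,∞)`, and let the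
steady kinematic law `∇(⟪u,∇T⟫ − ΔT) × (x−x₀) = ∇⟪u, x−x₀⟫ × ∇T` hold off the centre for the dipole potential `T`.  For
`r > 0` with `A(r) ≠ 0`, a unit vector `e ⊥ A(r)` and `c² + s² = 1`, the loop momentum `m = ⟪u, x − x₀⟫` is constant along the
latitude circle `φ ↦ x₀ + rc·Â(r) + rs·(cos φ·e + sin φ·(Â(r) × e))`.  (Radial component of the law:
`⟪∇m × ∇T, x−x₀⟫ = 0`; on `S_r`, `∇T = A(r)/r + κ·(x−x₀)`, and the circle's velocity is `Â × (x−x₀)`.) [folklore] -/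
theorem loopMomentum_const_on_latitudeCircle (u : EuclideanSpace ℝ (Fin 3) → EuclideanSpace ℝ (Fin 3))
    (x₀ : EuclideanSpace ℝ (Fin 3)) (A : ℝ → EuclideanSpace ℝ (Fin 3)) (R : ℝ → ℝ)
    (hu : ContDiff ℝ 1 u) (hA : ContDiffOn ℝ 3 A (Set.Ioi 0)) (hR : ContDiffOn ℝ 3 R (Set.Ioi 0))
    (hlaw : ∀ x ∈ ({x₀}ᶜ : Set (EuclideanSpace ℝ (Fin 3))),
      cross (gradient (fun z => ⟪u z, gradient (fun x => ⟪A ‖x - x₀‖, x - x₀⟫ / ‖x - x₀‖ + R ‖x - x₀‖) z⟫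
          - Δ (fun x => ⟪A ‖x - x₀‖, x - x₀⟫ / ‖x - x₀‖ + R ‖x - x₀‖) z) x) (x - x₀)
        = cross (gradient (fun z => ⟪u z, z - x₀⟫) x)
            (gradient (fun x => ⟪A ‖x - x₀‖, x - x₀⟫ / ‖x - x₀‖ + R ‖x - x₀‖) x))
    {r : ℝ} (hr : 0 < r) (hAr : A r ≠ 0) {e : EuclideanSpace ℝ (Fin 3)} (he : ‖e‖ = 1) (hAe : ⟪A r, e⟫ = 0)
    {c s : ℝ} (hcs : c ^ 2 + s ^ 2 = 1) (φ₁ φ₂ : ℝ) :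
    ⟪u (x₀ + (r * c) • (‖A r‖⁻¹ • A r) + (r * s) • (Real.cos φ₁ • e + Real.sin φ₁ • cross (‖A r‖⁻¹ • A r) e)),
        (x₀ + (r * c) • (‖A r‖⁻¹ • A r) + (r * s) • (Real.cos φ₁ • e + Real.sin φ₁ • cross (‖A r‖⁻¹ • A r) e)) - x₀⟫
      = ⟪u (x₀ + (r * c) • (‖A r‖⁻¹ • A r) + (r * s) • (Real.cos φ₂ • e + Real.sin φ₂ • cross (‖A r‖⁻¹ • A r) e)),
        (x₀ + (r * c) • (‖A r‖⁻¹ • A r) + (r * s) • (Real.cos φ₂ • e + Real.sin φ₂ • cross (‖A r‖⁻¹ • A r) e)) - x₀⟫ := by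
  set T : EuclideanSpace ℝ (Fin 3) → ℝ := fun x => ⟪A ‖x - x₀‖, x - x₀⟫ / ‖x - x₀‖ + R ‖x - x₀‖ with hTdef
  have hT : ∀ z, T z = ⟪A ‖z - x₀‖, z - x₀⟫ / ‖z - x₀‖ + R ‖z - x₀‖ := fun z => rfl
  set m : EuclideanSpace ℝ (Fin 3) → ℝ := fun z => ⟪u z, z - x₀⟫ with hmdef
  set n : EuclideanSpace ℝ (Fin 3) := ‖A r‖⁻¹ • A r with hn
  have hAn0 : ‖A r‖ ≠ 0 := norm_ne_zero_iff.mpr hAr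
  have hn1 : ‖n‖ = 1 := by rw [hn, norm_smul, norm_inv, norm_norm, inv_mul_cancel₀ hAn0]
  have hne : ⟪n, e⟫ = 0 := by rw [hn, real_inner_smul_left, hAe, mul_zero]
  have hAn : A r = ‖A r‖ • n := by rw [hn, smul_smul, mul_inv_cancel₀ hAn0, one_smul]
  clear_value n
  set γ : ℝ → EuclideanSpace ℝ (Fin 3) :=
    fun φ => x₀ + (r * c) • n + (r * s) • (Real.cos φ • e + Real.sin φ • cross n e) with hγ
  -- `m` is differentiable, with derivative `⟪∇m, γ′⟫ = 0` along the circle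
  have hmd : ∀ z, DifferentiableAt ℝ m z := fun z =>
    (hu.differentiable one_ne_zero z).inner ℝ (differentiableAt_id.sub (differentiableAt_const x₀))
  have hderiv : ∀ φ, HasDerivAt (fun φ => m (γ φ)) 0 φ := by
    intro φ
    have hγ' := hasDerivAt_latitudeCircle n e x₀ r c s φ
    have hcomp : HasDerivAt (fun φ => m (γ φ))
        (fderiv ℝ m (γ φ) ((r * s) • ((-Real.sin φ) • e + Real.cos φ • cross n e))) φ :=
      (hmd (γ φ)).hasFDerivAt.comp_hasDerivAt φ hγ'
    refine hcomp.congr_deriv ?_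
    -- the point is on the sphere, off the centre
    have hsph : ‖γ φ - x₀‖ = r := latitudeCircle_mem_sphere hn1 he hne hr hcs φ
    have hp : γ φ ≠ x₀ := by
      intro h; rw [h, sub_self, norm_zero] at hsph; exact hr.ne' hsph.symm
    -- the radial component of the law at `γ φ`
    have hE := hlaw (γ φ) hp
    have hrad : ⟪cross (gradient m (γ φ)) (gradient T (γ φ)), γ φ - x₀⟫ = 0 := by
      rw [← hE]; exact inner_cross_self_right _ _
    -- `∇T` on the sphere
    obtain ⟨κ, hκ⟩ := dipole_gradient_sphere hT hA hR hr hsph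
    rw [add_sub_cancel] at hκ
    rw [hκ, hAn, smul_smul, PointSource.cross_add_right, PointSource.cross_smul_right, PointSource.cross_smul_right,
      inner_add_left, real_inner_smul_left, real_inner_smul_left, inner_cross_self_right, mul_zero, add_zero] at hrad
    have hkey : ⟪cross (gradient m (γ φ)) n, γ φ - x₀⟫ = 0 := by
      rcases mul_eq_zero.mp hrad with h | h
      · exact absurd h (mul_ne_zero (inv_ne_zero hr.ne') hAn0)
      · exact h
    rw [← InnerProductSpace.toDual_symm_apply, ← gradient, ← cross_axis_latitudeCircle hn1 hne r c s φ,
      inner_cross_right_eq_inner_cross_left]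
    exact hkey
  have hdiff : Differentiable ℝ fun φ => m (γ φ) := fun φ => (hderiv φ).differentiableAt
  exact is_const_of_deriv_eq_zero hdiff (fun φ => (hderiv φ).deriv) φ₁ φ₂

/-- **LOOP LAW, step 2: the reduced scalar `L = ⟪u,∇T⟫ − ΔT` is constant on latitude circles** (same setting as
`loopMomentum_const_on_latitudeCircle`; the `∇T`-component of the law: `⟪∇L × (x−x₀), ∇T⟫ = ⟪∇m × ∇T, ∇T⟫ = 0`, and on
`S_r` the vector `∇T` is `A(r)/r` up to a radial part). [folklore] -/
theorem reducedScalar_const_on_latitudeCircle (u : EuclideanSpace ℝ (Fin 3) → EuclideanSpace ℝ (Fin 3))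
    (x₀ : EuclideanSpace ℝ (Fin 3)) (A : ℝ → EuclideanSpace ℝ (Fin 3)) (R : ℝ → ℝ)
    (hu : ContDiff ℝ 1 u) (hA : ContDiffOn ℝ 3 A (Set.Ioi 0)) (hR : ContDiffOn ℝ 3 R (Set.Ioi 0))
    (hlaw : ∀ x ∈ ({x₀}ᶜ : Set (EuclideanSpace ℝ (Fin 3))),
      cross (gradient (fun z => ⟪u z, gradient (fun x => ⟪A ‖x - x₀‖, x - x₀⟫ / ‖x - x₀‖ + R ‖x - x₀‖) z⟫
          - Δ (fun x => ⟪A ‖x - x₀‖, x - x₀⟫ / ‖x - x₀‖ + R ‖x - x₀‖) z) x) (x - x₀)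
        = cross (gradient (fun z => ⟪u z, z - x₀⟫) x)
            (gradient (fun x => ⟪A ‖x - x₀‖, x - x₀⟫ / ‖x - x₀‖ + R ‖x - x₀‖) x))
    {r : ℝ} (hr : 0 < r) (hAr : A r ≠ 0) {e : EuclideanSpace ℝ (Fin 3)} (he : ‖e‖ = 1) (hAe : ⟪A r, e⟫ = 0)
    {c s : ℝ} (hcs : c ^ 2 + s ^ 2 = 1) (φ₁ φ₂ : ℝ) :
    (fun z => ⟪u z, gradient (fun x => ⟪A ‖x - x₀‖, x - x₀⟫ / ‖x - x₀‖ + R ‖x - x₀‖) z⟫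
        - Δ (fun x => ⟪A ‖x - x₀‖, x - x₀⟫ / ‖x - x₀‖ + R ‖x - x₀‖) z)
      (x₀ + (r * c) • (‖A r‖⁻¹ • A r) + (r * s) • (Real.cos φ₁ • e + Real.sin φ₁ • cross (‖A r‖⁻¹ • A r) e))
    = (fun z => ⟪u z, gradient (fun x => ⟪A ‖x - x₀‖, x - x₀⟫ / ‖x - x₀‖ + R ‖x - x₀‖) z⟫
        - Δ (fun x => ⟪A ‖x - x₀‖, x - x₀⟫ / ‖x - x₀‖ + R ‖x - x₀‖) z)
      (x₀ + (r * c) • (‖A r‖⁻¹ • A r) + (r * s) • (Real.cos φ₂ • e + Real.sin φ₂ • cross (‖A r‖⁻¹ • A r) e)) := by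
  set T : EuclideanSpace ℝ (Fin 3) → ℝ := fun x => ⟪A ‖x - x₀‖, x - x₀⟫ / ‖x - x₀‖ + R ‖x - x₀‖ with hTdef
  have hT : ∀ z, T z = ⟪A ‖z - x₀‖, z - x₀⟫ / ‖z - x₀‖ + R ‖z - x₀‖ := fun z => rfl
  set L : EuclideanSpace ℝ (Fin 3) → ℝ := fun z => ⟪u z, gradient T z⟫ - (Δ T) z with hLdef
  set n : EuclideanSpace ℝ (Fin 3) := ‖A r‖⁻¹ • A r with hn
  have hAn0 : ‖A r‖ ≠ 0 := norm_ne_zero_iff.mpr hAr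
  have hn1 : ‖n‖ = 1 := by rw [hn, norm_smul, norm_inv, norm_norm, inv_mul_cancel₀ hAn0]
  have hne : ⟪n, e⟫ = 0 := by rw [hn, real_inner_smul_left, hAe, mul_zero]
  have hAn : A r = ‖A r‖ • n := by rw [hn, smul_smul, mul_inv_cancel₀ hAn0, one_smul]
  clear_value n
  set γ : ℝ → EuclideanSpace ℝ (Fin 3) :=
    fun φ => x₀ + (r * c) • n + (r * s) • (Real.cos φ • e + Real.sin φ • cross n e) with hγ
  -- `L` is differentiable off the centre
  have hLd : ∀ z, z ≠ x₀ → DifferentiableAt ℝ L z := by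
    intro z hz
    have h3 := dipole_contDiffAt hT hA hR hz
    exact ((hu.differentiable one_ne_zero z).inner ℝ (dipole_differentiableAt_gradient h3)).sub
      (dipole_differentiableAt_laplacian h3)
  have hderiv : ∀ φ, HasDerivAt (fun φ => L (γ φ)) 0 φ := by
    intro φ
    have hsph : ‖γ φ - x₀‖ = r := latitudeCircle_mem_sphere hn1 he hne hr hcs φ
    have hp : γ φ ≠ x₀ := by
      intro h; rw [h, sub_self, norm_zero] at hsph; exact hr.ne' hsph.symm
    have hγ' := hasDerivAt_latitudeCircle n e x₀ r c s φ
    have hcomp : HasDerivAt (fun φ => L (γ φ))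
        (fderiv ℝ L (γ φ) ((r * s) • ((-Real.sin φ) • e + Real.cos φ • cross n e))) φ :=
      (hLd (γ φ) hp).hasFDerivAt.comp_hasDerivAt φ hγ'
    refine hcomp.congr_deriv ?_
    -- the `∇T`-component of the law at `γ φ`
    have hE := hlaw (γ φ) hp
    have htan : ⟪cross (gradient L (γ φ)) (γ φ - x₀), gradient T (γ φ)⟫ = 0 := by
      rw [hE]; exact inner_cross_self_right _ _
    obtain ⟨κ, hκ⟩ := dipole_gradient_sphere hT hA hR hr hsph
    rw [add_sub_cancel] at hκ
    rw [hκ, hAn, smul_smul, inner_add_right, real_inner_smul_right, real_inner_smul_right, inner_cross_self_right,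
      mul_zero, add_zero] at htan
    have hkey : ⟪cross (gradient L (γ φ)) (γ φ - x₀), n⟫ = 0 := by
      rcases mul_eq_zero.mp htan with h | h
      · exact absurd h (mul_ne_zero (inv_ne_zero hr.ne') hAn0)
      · exact h
    rw [← InnerProductSpace.toDual_symm_apply, ← gradient, ← cross_axis_latitudeCircle hn1 hne r c s φ,
      inner_cross_right_eq_inner_cross_left, inner_cross_left_swap, hkey, neg_zero]
  have hdiff : Differentiable ℝ fun φ => L (γ φ) := fun φ => (hderiv φ).differentiableAt
  exact is_const_of_deriv_eq_zero hdiff (fun φ => (hderiv φ).deriv) φ₁ φ₂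

end Summit.NavierStokesRegularity.NavierStokesRegularity.Theorems.PoloidalLiouville.FluxStarvedDipole

end
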